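import Mathlib
import Literature.NumberTheory.LFunctions.Zhang2022.Section8cStatements
import Literature.NumberTheory.LFunctions.Zhang2022.Section8dStatements
import Literature.NumberTheory.LFunctions.Zhang2022.SkeletonReductions
import HarnessLib

/-!
# Zhang (2022) §8: the top of the `Ded823` chain in the kernel — (8.12) ⇒ `§8.u055` ⇒ `§8.u056` ⇒ (8.23)

Topic `Literature/NumberTheory/LFunctions/Zhang2022` (Landau–Siegel audit tree; verdict-neutral).
D-0069 campaign, cell `siegel-zhang`, DISCHARGE board `plan/DISCHARGE.tsv` row **D01** (cone C22,
`Skeleton.Ded823 c′ : Eq87 → Prop71 → Lemma82 → Lemma83 → Lemma84 → Eval823`), seat sz-d29.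
Y. Zhang, *Discrete mean estimates and the Landau–Siegel zero*, arXiv:2211.02515v1 (2022)
[Zhang2022LandauSiegel], §8 pp. 48–50 (tex L2473–L2550 of `lsz3__2_.tex`) — **an unrefereed
manuscript under adjudication; this file proves IMPLICATIONS BETWEEN TYPED NODES of the manuscript
and asserts nothing about its Theorems 1–2 or about Landau–Siegel zeros.** Theorem-only (no new
definitions, no new facts, no numerics).

What is proved (all over the landed typed nodes of `Section8cStatements` (L2-t8, p412011) and
`Section8dStatements` (L2-t9, p411983), and the banked skeleton):

| decl | DAG node(s) | content |
|---|---|---|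
| `frakA_le_ell_pow_four` | (2.31) | `𝔞 ≤ 96e⁹π⁻²·𝓛⁴` for `χ` primitive, `𝓛 ≥ 3` (tree: `Lemma31.norm_deriv_LFunction_le_near_one`) |
| `S812_at_scales` | `Z22:(8.12)` | the tree functional `S812` at `(𝓛⁹, 0.504, θ₂)` IS the printed right side of (8.12) (`P₁/P₂ = P^{0.004}T^{10}`) |
| `weighted_mains_eq` | `Z22:§8.u055` | EXACT identity: the weighted `z`-integral main terms (weights `(2α)⁻¹, 2α⁻¹, (3/2)α⁻¹`, `α log P = π`) equal `Theta1Coeff = b₁₁ + ι₂b₂₁ + ῑ₂b₁₂ + |ι₂|²b₂₂` ((8.19)–(8.22)) |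
| `sj_approx_of_eq812q` | `Z22:(8.12)`, `§8.u051`–`u054` | `S_j(𝐚₁₁,𝐚₂₁) = 𝔞·M_j + O(ηα + 𝔞α𝓛⁻⁷)` |
| `step8u055_of_eq812q` | `Z22:§8.u055` | **`Eq812 ∧ u051q ∧ u052q ∧ u053q ∧ u054q ⇒ Step8u055`** |
| `ecal_small_of_eq812q` | (implicit, p.50) | **`E(𝐚₁₁,𝐚₂₁) = 𝔓𝓛²Σ_j|S_j| = o(𝔓)`** from the same inputs |
| `step8u056_of`, `dedStep8u056_of_ecal` | `Z22:§8.u056` | **`Step8u055 ∧ E = o(𝔓) ∧ Prop71 ⇒ Step8u056`** (the typed `DedStep8u056` given its implicit input) |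
| `ded823_of_eq812q` | `Z22:(8.23)` / `Skeleton.Ded823` | **`Eq812 ∧ u051q … u054q ⇒ Skeleton.Ded823 c′`** (with `Section8dStatements.dedEval823_holds`) |

GRANULARITY NOTE (recorded, not a gap): the typed `Step8u051`–`Step8u054` carry the printed `+ o(α)`;
the next printed step ("Inserting these into (8.12)", `Step8u055`, `+ o(1)`) multiplies those errors by
`𝔞·w_j/α`, and `𝔞 = (6/π²)L′(1,χ)²∏_{q∣D}q/(q+1)` is only `≪ 𝓛⁴` (no `O(1)` bound is available under
(A)). The manuscript's ACTUAL errors in the four displays are `O(α𝓛⁻⁸)` (from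
`𝔣_{jμ}(Pᶻ) = 𝔣𝔣_{jμ}(z) + O(𝓛⁻⁸)`, `Step8u049/050`) and `O(α𝓛^{−7.9})` (`log P₂ = (0.5 − 10𝓛^{−7.9})log P`),
so the printed inference is sound; the theorems here therefore consume the four displays in the
QUANTITATIVE form "`≤ C·α·𝓛⁻⁷`" (hypotheses `h51`–`h54`, any exponent `> 4` works), which is what
their dischargers (seat d19) establish, and from which the typed `o(α)` forms follow trivially.

WHAT THIS FILE IS NOT: a proof of (8.12) itself (front end of the chain: Lemmas 8.2–8.4 ⇒ (8.11),
other seats), nor of Proposition 7.1 / (8.7); not a statement about (8.24) (refuted in the tree,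
`not_ineq824`) or about Theorems 1–2 / Landau–Siegel zeros.

## References

* Y. Zhang, arXiv:2211.02515v1 (2022), §8 (8.12)–(8.23), pp. 48–50; §7 Prop. 7.1; §2 (2.10),
  (2.21), (2.31). [cite: Zhang2022LandauSiegel, §8 pp. 48–50]
-/

noncomputable section

open Complex Real ComplexConjugate Set MeasureTheory


namespace Literature.NumberTheory.LFunctions.Zhang2022.Section8Ded823

open Skeleton Section8dStatements Section8cStatements

/-! ### Elementary facts about the parameters -/

/-- `𝓛 = log D ≥ 3` once `D ≥ 21` (`e³ < 21`). [cite: Zhang2022LandauSiegel, §2 (2.1)] -/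
theorem three_le_ell {D : ℕ} (hD : 21 ≤ D) : 3 ≤ ell D := by
  have hD' : (21 : ℝ) ≤ D := by exact_mod_cast hD
  rw [ell, Real.le_log_iff_exp_le (by linarith)]
  have h3 : Real.exp 3 = Real.exp 1 ^ 3 := by rw [← Real.exp_nat_mul]; norm_num
  rw [h3]
  have h1 : Real.exp 1 ^ 3 < 2.7182818286 ^ 3 :=
    pow_lt_pow_left₀ Real.exp_one_lt_d9 (Real.exp_pos 1).le (by norm_num)
  have h2 : (2.7182818286 : ℝ) ^ 3 < 21 := by norm_num
  linarith

/-! ### `𝔞 ≪ 𝓛⁴` -/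

/-- **`𝔞 ≤ 96e⁹π⁻²·𝓛⁴`** for `χ` primitive and `𝓛 = log D ≥ 3`: from the tree's Cauchy bound
`‖L′(1,χ)‖ ≤ 2e^{9/2}(1 + 𝓛)𝓛` (`Lemma31.norm_deriv_LFunction_le_near_one`) and
`∏_{q∣D} q/(q+1) ≤ 1` in (2.31). [cite: Zhang2022LandauSiegel, §2 (2.31)] -/
theorem frakA_le_ell_pow_four {D : ℕ} [NeZero D] (χ : DirichletCharacter ℂ D)
    (hprim : χ.IsPrimitive) (hD : 3 ≤ ell D) :
    frakA χ ≤ 96 * Real.exp 9 / π ^ 2 * ell D ^ 4 := by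
  have hL : 3 ≤ Real.log D := hD
  have hder := Lemma31.norm_deriv_LFunction_le_near_one χ hL hprim (w := 1)
    (by simp; positivity)
  have hℓ0 : 0 ≤ ell D := by linarith
  -- `‖L′(1,χ)‖ ≤ 4e^{9/2}𝓛²`
  have hder' : ‖deriv χ.LFunction 1‖ ≤ 4 * Real.exp (9 / 2) * ell D ^ 2 := by
    refine hder.trans ?_
    rw [show Real.log D = ell D from rfl]
    have h1 : 1 + ell D ≤ 2 * ell D := by linarith
    have he : 0 ≤ Real.exp (9 / 2) := (Real.exp_pos _).le
    nlinarith [mul_nonneg he hℓ0]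
  have hre : (deriv χ.LFunction 1).re ^ 2 ≤ ‖deriv χ.LFunction 1‖ ^ 2 := by
    rw [← sq_abs]
    exact pow_le_pow_left₀ (abs_nonneg _) (Complex.abs_re_le_norm _) 2
  have h1 : (deriv χ.LFunction 1).re ^ 2 ≤ (4 * Real.exp (9 / 2) * ell D ^ 2) ^ 2 :=
    hre.trans (pow_le_pow_left₀ (norm_nonneg _) hder' 2)
  have h2 : (4 * Real.exp (9 / 2) * ell D ^ 2) ^ 2 = 16 * Real.exp 9 * ell D ^ 4 := by
    have : Real.exp (9 / 2) ^ 2 = Real.exp 9 := by rw [← Real.exp_nat_mul]; norm_num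
    rw [mul_pow, mul_pow, this]; ring
  have hprod : ∏ p ∈ D.primeFactors, ((p : ℝ) / (p + 1)) ≤ 1 :=
    Finset.prod_le_one (fun p _ => by positivity)
      (fun p _ => by rw [div_le_one (by positivity)]; linarith)
  have hprod0 : 0 ≤ ∏ p ∈ D.primeFactors, ((p : ℝ) / (p + 1)) :=
    Finset.prod_nonneg fun p _ => by positivity
  rw [Skeleton.frakA, Lemma171.frakA]
  calc 6 / π ^ 2 * (deriv χ.LFunction 1).re ^ 2 * ∏ p ∈ D.primeFactors, ((p : ℝ) / (p + 1))
      ≤ 6 / π ^ 2 * (16 * Real.exp 9 * ell D ^ 4) * 1 := by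
        apply mul_le_mul _ hprod hprod0 (by positivity)
        exact mul_le_mul_of_nonneg_left (h1.trans_eq h2) (by positivity)
    _ = 96 * Real.exp 9 / π ^ 2 * ell D ^ 4 := by ring

/-! ### (8.12) at the manuscript's scales -/

/-- The tree's functional `S812` at the manuscript's scales `(Λ, θ₁, θ₂) = (𝓛⁹, 0.504, θ₂)`, unfolded
with `P^{0.504} = P₁`, `P^{θ₂} = P₂`, `P₁/P₂ = P^{0.004}T^{10}`: it is the printed right side of
(8.12) (without `𝔞`, `o(α)`). [cite: Zhang2022LandauSiegel, §8 (8.12) p.48, tex L2473] -/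
theorem S812_at_scales {D : ℕ} (hD : ell D ≠ 0) (F6 F7 G6 G7 : ℝ → ℂ) :
    S812 F6 F7 G6 G7 (ell D ^ 9) 0.504 (theta2 D) =
      1 / (Real.log (Skeleton.P1 D) : ℂ) ^ 2 * (∫ x in (1 : ℝ)..Skeleton.P1 D, F6 x * G6 x / x) +
        (Complex.normSq iota2 : ℂ) / (Real.log (Skeleton.P2 D) : ℂ) ^ 2 *
          (∫ x in (1 : ℝ)..Skeleton.P2 D, F7 x * G7 x / x) +
        iota2 / (Real.log (Skeleton.P1 D) * Real.log (Skeleton.P2 D) : ℂ) *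
          (∫ x in (1 : ℝ)..Skeleton.P2 D, F7 x * G6 (bigP D ^ (0.004 : ℝ) * bigT D ^ 10 * x) / x) +
        conj iota2 / (Real.log (Skeleton.P1 D) * Real.log (Skeleton.P2 D) : ℂ) *
          (∫ x in (1 : ℝ)..Skeleton.P2 D, F6 (bigP D ^ (0.004 : ℝ) * bigT D ^ 10 * x) * G7 x / x) := by
  -- `P₁/P₂ = P^{0.004}T^{10}` ((2.21); cf. `Typed.S8B.P1_div_P2`)
  have hP : 0 < bigP D := Real.exp_pos _
  have hsub : bigP D ^ (0.004 : ℝ) = bigP D ^ (0.504 : ℝ) / bigP D ^ (0.5 : ℝ) := by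
    rw [← Real.rpow_sub hP]; norm_num
  have hdiv : Skeleton.P1 D / Skeleton.P2 D = bigP D ^ (0.004 : ℝ) * bigT D ^ 10 := by
    rw [Skeleton.P1, Skeleton.P2, hsub]
    field_simp
  unfold S812
  rw [Ppow_theta1, Ppow_theta2 D hD, hdiv]

/-! ### Generic norm bookkeeping -/

/-- `‖(2α)⁻¹X₁ + 2α⁻¹X₂ + (3/2)α⁻¹X₃‖ ≤ 4δ/α` when each `‖X_j‖ ≤ δ` (the weights `1/2, 2, 3/2` of
Proposition 7.1 sum to `4`). [cite: Zhang2022LandauSiegel, §7 Prop. 7.1] -/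
theorem norm_weighted3_le {a : ℝ} (ha : 0 < a) {X₁ X₂ X₃ : ℂ} {δ : ℝ}
    (h₁ : ‖X₁‖ ≤ δ) (h₂ : ‖X₂‖ ≤ δ) (h₃ : ‖X₃‖ ≤ δ) :
    ‖1 / (2 * (a : ℂ)) * X₁ + 2 / (a : ℂ) * X₂ + 3 / (2 * (a : ℂ)) * X₃‖ ≤ 4 * δ / a := by
  have ha' : (a : ℂ) ≠ 0 := by exact_mod_cast ha.ne'
  have e : 1 / (2 * (a : ℂ)) * X₁ + 2 / (a : ℂ) * X₂ + 3 / (2 * (a : ℂ)) * X₃ =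
      ((1 / a : ℝ) : ℂ) * ((1 / 2 : ℂ) * X₁ + 2 * X₂ + (3 / 2 : ℂ) * X₃) := by
    push_cast; field_simp
  have n1 : ‖(1 / 2 : ℂ)‖ = 1 / 2 := by norm_num
  have n2 : ‖(2 : ℂ)‖ = 2 := by norm_num
  have n3 : ‖(3 / 2 : ℂ)‖ = 3 / 2 := by norm_num
  have inner : ‖(1 / 2 : ℂ) * X₁ + 2 * X₂ + (3 / 2 : ℂ) * X₃‖ ≤ 1 / 2 * δ + 2 * δ + 3 / 2 * δ := by
    refine (norm_add₃_le).trans ?_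
    rw [norm_mul, norm_mul, norm_mul, n1, n2, n3]
    gcongr
  rw [e, norm_mul, Complex.norm_real, Real.norm_eq_abs, abs_of_pos (by positivity)]
  calc 1 / a * ‖(1 / 2 : ℂ) * X₁ + 2 * X₂ + (3 / 2 : ℂ) * X₃‖
      ≤ 1 / a * (1 / 2 * δ + 2 * δ + 3 / 2 * δ) := by gcongr
    _ = 4 * δ / a := by ring

/-- Termwise comparison of the four-term shape `T₁ + |ι₂|²T₂ + ι₂T₃ + ῑ₂T₄` of (8.12).
[cite: Zhang2022LandauSiegel, §8 (8.12) p.48] -/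
theorem norm_four_sub_le (T₁ T₂ T₃ T₄ m₁ m₂ m₃ m₄ : ℂ) :
    ‖(T₁ + (Complex.normSq iota2 : ℂ) * T₂ + iota2 * T₃ + conj iota2 * T₄) -
        (m₁ + (Complex.normSq iota2 : ℂ) * m₂ + iota2 * m₃ + conj iota2 * m₄)‖ ≤
      ‖T₁ - m₁‖ + Complex.normSq iota2 * ‖T₂ - m₂‖ + ‖iota2‖ * ‖T₃ - m₃‖ + ‖iota2‖ * ‖T₄ - m₄‖ := by
  have e : (T₁ + (Complex.normSq iota2 : ℂ) * T₂ + iota2 * T₃ + conj iota2 * T₄) -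
        (m₁ + (Complex.normSq iota2 : ℂ) * m₂ + iota2 * m₃ + conj iota2 * m₄) =
      (T₁ - m₁) + (Complex.normSq iota2 : ℂ) * (T₂ - m₂) + iota2 * (T₃ - m₃) +
        conj iota2 * (T₄ - m₄) := by ring
  have hn : ‖(Complex.normSq iota2 : ℂ)‖ = Complex.normSq iota2 :=
    Complex.norm_of_nonneg (Complex.normSq_nonneg _)
  rw [e]
  refine (norm_add_le _ _).trans ?_
  refine add_le_add ((norm_add₃_le).trans ?_) ?_
  · rw [norm_mul, norm_mul, hn]
  · rw [norm_mul, Complex.norm_conj]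

/-! ### "Inserting these into (8.12)": the exact identity behind the display before (8.19) -/

/-- **The weighted `z`-integral main terms ARE `b₁₁ + ι₂b₂₁ + ῑ₂b₁₂ + |ι₂|²b₂₂`.** With
`α = π/L` (`L = log P`), the weighted sum (weights `(2α)⁻¹, 2α⁻¹, (3/2)α⁻¹` of Prop. 7.1) of the
main terms of the four "Substituting `x = Pᶻ`" displays (p.49) over `j = 1, 2, 3` equals the
tree's `Theta1Coeff` EXACTLY (the printed (8.19)–(8.22): `b11_split` … `b12_split`).
[cite: Zhang2022LandauSiegel, §8 p.49, tex L2523] -/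
theorem weighted_mains_eq {L : ℝ} (hL : L ≠ 0) (m : ℕ → ℂ)
    (hm : ∀ j : ℕ, m j =
      (((1 / (0.504 ^ 2 * L)) : ℝ) : ℂ) * (∫ z in (0 : ℝ)..0.504, ffP j 6 z * ghP j 6 z) +
        (Complex.normSq iota2 : ℂ) *
          ((((1 / (0.5 ^ 2 * L)) : ℝ) : ℂ) * ∫ z in (0 : ℝ)..0.5, ffP j 7 z * ghP j 7 z) +
        iota2 * ((((1 / (0.5 * 0.504 * L)) : ℝ) : ℂ) *
          ∫ z in (0 : ℝ)..0.5, ffP j 7 z * ghP j 6 (z + 0.004)) +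
        conj iota2 * ((((1 / (0.5 * 0.504 * L)) : ℝ) : ℂ) *
          ∫ z in (0 : ℝ)..0.5, ffP j 6 (z + 0.004) * ghP j 7 z)) :
    1 / (2 * ((π / L : ℝ) : ℂ)) * m 1 + 2 / ((π / L : ℝ) : ℂ) * m 2 +
        3 / (2 * ((π / L : ℝ) : ℂ)) * m 3 = Theta1Coeff := by
  have hLC : (L : ℂ) ≠ 0 := by exact_mod_cast hL
  have hπ : (π : ℂ) ≠ 0 := by exact_mod_cast Real.pi_ne_zero
  rw [hm 1, hm 2, hm 3, ffP_one_six, ffP_two_six, ffP_three_six, ffP_one_seven, ffP_two_seven,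
    ffP_three_seven, ghP_one_six, ghP_two_six, ghP_three_six, ghP_one_seven, ghP_two_seven,
    ghP_three_seven, Theta1Coeff, b11_split, b22_split, b21_split, b12_split]
  push_cast
  field_simp
  ring

/-! ### The core approximation: `S_j(𝐚₁₁,𝐚₂₁) = 𝔞·M_j + (η + O(𝔞𝓛⁻⁷))α` -/

section Core

variable (c' : ℝ)

/-- **(8.12) + the four QUANTITATIVE "Substituting `x = Pᶻ`" displays ⇒ `S_j(𝐚₁₁,𝐚₂₁)` is
`𝔞` times the weighted `z`-integrals, up to `ηα + O(𝔞·α𝓛⁻⁷)`** (`j = 1, 2, 3`, under (A), for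
every `η > 0`, eventually in `D`). The four hypotheses `h51`–`h54` are the displays after (8.18)
(`Z22:§8.u051`–`§8.u054`, `Section8dStatements.Step8u051`–`Step8u054`) with the explicit error
`C·α·𝓛⁻⁷` in place of the printed `o(α)` (the manuscript's actual error there is
`O(α𝓛⁻⁸) + O(α𝓛^{−7.9})`; the printed `o(α)` is too coarse for the next step, since it gets
multiplied by `𝔞/α` and `𝔞` is only `≪ 𝓛⁴`). [cite: Zhang2022LandauSiegel, §8 (8.12) p.48 and p.49] -/
theorem sj_approx_of_eq812q (h812 : Eq812 c')
    (h51 : ∃ C : ℝ, ForAllLarge fun D _ _ => ∀ j ∈ ({1, 2, 3} : Finset ℕ),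
      ‖1 / (Real.log (Skeleton.P1 D) : ℂ) ^ 2 *
            (∫ x in (1 : ℝ)..Skeleton.P1 D, frakfW c' D j 6 x * frakgW c' D j 6 x / x) -
          ((1 / (0.504 ^ 2 * Real.log (bigP D)) : ℝ) : ℂ) *
            ∫ z in (0 : ℝ)..0.504, ffP j 6 z * ghP j 6 z‖ ≤ C * alpha D * (ell D ^ 7)⁻¹)
    (h52 : ∃ C : ℝ, ForAllLarge fun D _ _ => ∀ j ∈ ({1, 2, 3} : Finset ℕ),
      ‖1 / (Real.log (Skeleton.P2 D) : ℂ) ^ 2 *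
            (∫ x in (1 : ℝ)..Skeleton.P2 D, frakfW c' D j 7 x * frakgW c' D j 7 x / x) -
          ((1 / (0.5 ^ 2 * Real.log (bigP D)) : ℝ) : ℂ) *
            ∫ z in (0 : ℝ)..0.5, ffP j 7 z * ghP j 7 z‖ ≤ C * alpha D * (ell D ^ 7)⁻¹)
    (h53 : ∃ C : ℝ, ForAllLarge fun D _ _ => ∀ j ∈ ({1, 2, 3} : Finset ℕ),
      ‖1 / (Real.log (Skeleton.P1 D) * Real.log (Skeleton.P2 D) : ℂ) *
            (∫ x in (1 : ℝ)..Skeleton.P2 D, frakfW c' D j 7 x *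
              frakgW c' D j 6 (bigP D ^ (0.004 : ℝ) * bigT D ^ 10 * x) / x) -
          ((1 / (0.5 * 0.504 * Real.log (bigP D)) : ℝ) : ℂ) *
            ∫ z in (0 : ℝ)..0.5, ffP j 7 z * ghP j 6 (z + 0.004)‖ ≤ C * alpha D * (ell D ^ 7)⁻¹)
    (h54 : ∃ C : ℝ, ForAllLarge fun D _ _ => ∀ j ∈ ({1, 2, 3} : Finset ℕ),
      ‖1 / (Real.log (Skeleton.P1 D) * Real.log (Skeleton.P2 D) : ℂ) *
            (∫ x in (1 : ℝ)..Skeleton.P2 D,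
              frakfW c' D j 6 (bigP D ^ (0.004 : ℝ) * bigT D ^ 10 * x) * frakgW c' D j 7 x / x) -
          ((1 / (0.5 * 0.504 * Real.log (bigP D)) : ℝ) : ℂ) *
            ∫ z in (0 : ℝ)..0.5, ffP j 6 (z + 0.004) * ghP j 7 z‖ ≤ C * alpha D * (ell D ^ 7)⁻¹)
    {η : ℝ} (hη : 0 < η) :
    ∃ K : ℝ, 0 ≤ K ∧ ForAllLarge fun D _ χ => AssumptionA D χ → ∀ j ∈ ({1, 2, 3} : Finset ℕ),
      ‖Sj c' D j (a11 χ) (a21 χ) -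
          (frakA χ : ℂ) *
            (((1 / (0.504 ^ 2 * Real.log (bigP D)) : ℝ) : ℂ) *
                (∫ z in (0 : ℝ)..0.504, ffP j 6 z * ghP j 6 z) +
              (Complex.normSq iota2 : ℂ) * (((1 / (0.5 ^ 2 * Real.log (bigP D)) : ℝ) : ℂ) *
                ∫ z in (0 : ℝ)..0.5, ffP j 7 z * ghP j 7 z) +
              iota2 * (((1 / (0.5 * 0.504 * Real.log (bigP D)) : ℝ) : ℂ) *
                ∫ z in (0 : ℝ)..0.5, ffP j 7 z * ghP j 6 (z + 0.004)) +
              conj iota2 * (((1 / (0.5 * 0.504 * Real.log (bigP D)) : ℝ) : ℂ) *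
                ∫ z in (0 : ℝ)..0.5, ffP j 6 (z + 0.004) * ghP j 7 z))‖ ≤
        η * alpha D + frakA χ * K * (alpha D * (ell D ^ 7)⁻¹) := by
  obtain ⟨C1, h51⟩ := h51
  obtain ⟨C2, h52⟩ := h52
  obtain ⟨C3, h53⟩ := h53
  obtain ⟨C4, h54⟩ := h54
  refine ⟨|C1| + Complex.normSq iota2 * |C2| + ‖iota2‖ * |C3| + ‖iota2‖ * |C4|,
    by have := Complex.normSq_nonneg iota2; positivity, ?_⟩
  have FL : ForAllLarge fun D _ _ => 3 ≤ ell D :=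
    ForAllLarge.of_le 21 fun D _ _ hD _ _ => three_le_ell hD
  refine ((((((h812 η hη).and h51).and h52).and h53).and h54).and FL).mono ?_
  intro D _ χ _ _ h hA j hj
  obtain ⟨⟨⟨⟨⟨e812, e51⟩, e52⟩, e53⟩, e54⟩, hℓ⟩ := h
  have hℓ0 : ell D ≠ 0 := by positivity
  have hα : 0 ≤ alpha D := by rw [Skeleton.alpha, log_bigP]; positivity
  have hαℓ : 0 ≤ alpha D * (ell D ^ 7)⁻¹ := by positivity
  have h𝔞 : 0 ≤ frakA χ := frakA_nonneg χ
  replace e812 := e812 hA j hj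
  replace e51 := e51 j hj
  replace e52 := e52 j hj
  replace e53 := e53 j hj
  replace e54 := e54 j hj
  rw [S812_at_scales hℓ0] at e812
  -- the four normalised `x`-integrals and their `z`-main terms
  set T₁ : ℂ := 1 / (Real.log (Skeleton.P1 D) : ℂ) ^ 2 *
    (∫ x in (1 : ℝ)..Skeleton.P1 D, frakfW c' D j 6 x * frakgW c' D j 6 x / x) with hT₁
  set T₂ : ℂ := 1 / (Real.log (Skeleton.P2 D) : ℂ) ^ 2 *
    (∫ x in (1 : ℝ)..Skeleton.P2 D, frakfW c' D j 7 x * frakgW c' D j 7 x / x) with hT₂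
  set T₃ : ℂ := 1 / (Real.log (Skeleton.P1 D) * Real.log (Skeleton.P2 D) : ℂ) *
    (∫ x in (1 : ℝ)..Skeleton.P2 D, frakfW c' D j 7 x *
      frakgW c' D j 6 (bigP D ^ (0.004 : ℝ) * bigT D ^ 10 * x) / x) with hT₃
  set T₄ : ℂ := 1 / (Real.log (Skeleton.P1 D) * Real.log (Skeleton.P2 D) : ℂ) *
    (∫ x in (1 : ℝ)..Skeleton.P2 D,
      frakfW c' D j 6 (bigP D ^ (0.004 : ℝ) * bigT D ^ 10 * x) * frakgW c' D j 7 x / x) with hT₄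
  set m₁ : ℂ := ((1 / (0.504 ^ 2 * Real.log (bigP D)) : ℝ) : ℂ) *
    ∫ z in (0 : ℝ)..0.504, ffP j 6 z * ghP j 6 z with hm₁
  set m₂ : ℂ := ((1 / (0.5 ^ 2 * Real.log (bigP D)) : ℝ) : ℂ) *
    ∫ z in (0 : ℝ)..0.5, ffP j 7 z * ghP j 7 z with hm₂
  set m₃ : ℂ := ((1 / (0.5 * 0.504 * Real.log (bigP D)) : ℝ) : ℂ) *
    ∫ z in (0 : ℝ)..0.5, ffP j 7 z * ghP j 6 (z + 0.004) with hm₃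
  set m₄ : ℂ := ((1 / (0.5 * 0.504 * Real.log (bigP D)) : ℝ) : ℂ) *
    ∫ z in (0 : ℝ)..0.5, ffP j 6 (z + 0.004) * ghP j 7 z with hm₄
  set S : ℂ := Sj c' D j (a11 χ) (a21 χ) with hS
  set X : ℂ := T₁ + (Complex.normSq iota2 : ℂ) * T₂ + iota2 * T₃ + conj iota2 * T₄ with hX
  set M : ℂ := m₁ + (Complex.normSq iota2 : ℂ) * m₂ + iota2 * m₃ + conj iota2 * m₄ with hM
  have eX : 1 / (Real.log (Skeleton.P1 D) : ℂ) ^ 2 *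
          (∫ x in (1 : ℝ)..Skeleton.P1 D, frakfW c' D j 6 x * frakgW c' D j 6 x / x) +
        (Complex.normSq iota2 : ℂ) / (Real.log (Skeleton.P2 D) : ℂ) ^ 2 *
          (∫ x in (1 : ℝ)..Skeleton.P2 D, frakfW c' D j 7 x * frakgW c' D j 7 x / x) +
        iota2 / (Real.log (Skeleton.P1 D) * Real.log (Skeleton.P2 D) : ℂ) *
          (∫ x in (1 : ℝ)..Skeleton.P2 D, frakfW c' D j 7 x *
            frakgW c' D j 6 (bigP D ^ (0.004 : ℝ) * bigT D ^ 10 * x) / x) +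
        conj iota2 / (Real.log (Skeleton.P1 D) * Real.log (Skeleton.P2 D) : ℂ) *
          (∫ x in (1 : ℝ)..Skeleton.P2 D,
            frakfW c' D j 6 (bigP D ^ (0.004 : ℝ) * bigT D ^ 10 * x) * frakgW c' D j 7 x / x) = X := by
    rw [hX, hT₁, hT₂, hT₃, hT₄]; ring
  rw [eX] at e812
  have hXM : ‖X - M‖ ≤ (|C1| + Complex.normSq iota2 * |C2| + ‖iota2‖ * |C3| + ‖iota2‖ * |C4|) *
      (alpha D * (ell D ^ 7)⁻¹) := by
    have b1 : ‖T₁ - m₁‖ ≤ |C1| * (alpha D * (ell D ^ 7)⁻¹) :=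
      e51.trans (by rw [mul_assoc]; exact mul_le_mul_of_nonneg_right (le_abs_self _) hαℓ)
    have b2 : ‖T₂ - m₂‖ ≤ |C2| * (alpha D * (ell D ^ 7)⁻¹) :=
      e52.trans (by rw [mul_assoc]; exact mul_le_mul_of_nonneg_right (le_abs_self _) hαℓ)
    have b3 : ‖T₃ - m₃‖ ≤ |C3| * (alpha D * (ell D ^ 7)⁻¹) :=
      e53.trans (by rw [mul_assoc]; exact mul_le_mul_of_nonneg_right (le_abs_self _) hαℓ)
    have b4 : ‖T₄ - m₄‖ ≤ |C4| * (alpha D * (ell D ^ 7)⁻¹) :=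
      e54.trans (by rw [mul_assoc]; exact mul_le_mul_of_nonneg_right (le_abs_self _) hαℓ)
    refine (norm_four_sub_le T₁ T₂ T₃ T₄ m₁ m₂ m₃ m₄).trans ?_
    have hn : 0 ≤ Complex.normSq iota2 := Complex.normSq_nonneg _
    have hi : 0 ≤ ‖iota2‖ := norm_nonneg _
    calc ‖T₁ - m₁‖ + Complex.normSq iota2 * ‖T₂ - m₂‖ + ‖iota2‖ * ‖T₃ - m₃‖ + ‖iota2‖ * ‖T₄ - m₄‖
        ≤ |C1| * (alpha D * (ell D ^ 7)⁻¹) + Complex.normSq iota2 * (|C2| * (alpha D * (ell D ^ 7)⁻¹)) +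
            ‖iota2‖ * (|C3| * (alpha D * (ell D ^ 7)⁻¹)) + ‖iota2‖ * (|C4| * (alpha D * (ell D ^ 7)⁻¹)) := by
          gcongr
      _ = _ := by ring
  have e : S - (frakA χ : ℂ) * M = (S - (frakA χ : ℂ) * X) + (frakA χ : ℂ) * (X - M) := by ring
  rw [e]
  refine (norm_add_le _ _).trans (add_le_add e812 ?_)
  rw [norm_mul, Complex.norm_of_nonneg h𝔞, mul_assoc]
  exact mul_le_mul_of_nonneg_left hXM h𝔞

end Core

/-! ### `Z22:§8.u055` from (8.12): "Inserting these into (8.12) we obtain …" -/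

section Main

variable (c' : ℝ)

/-- `𝓛 = log D ≥ c` once `D ≥ ⌈exp c⌉₊` ("`D` sufficiently large", (2.1)). [cite: Zhang2022LandauSiegel, §2 (2.1)] -/
theorem le_ell_of_le {c : ℝ} {D : ℕ} (hD : ⌈Real.exp c⌉₊ ≤ D) : c ≤ ell D := by
  have h1 : Real.exp c ≤ D := le_trans (Nat.le_ceil _) (by exact_mod_cast hD)
  rw [ell, Real.le_log_iff_exp_le (lt_of_lt_of_le (Real.exp_pos c) h1)]
  exact h1

/-- **`Z22:§8.u055` DISCHARGED from (8.12) and the quantitative substitution displays**: the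
manuscript's "Inserting these into (8.12) we obtain `(2α)⁻¹S₁ + 2α⁻¹S₂ + (3/2)α⁻¹S₃ =
𝔞(b₁₁ + ι₂b₂₁ + ῑ₂b₁₂ + |ι₂|²b₂₂) + o(1)`" (p.49, tex L2523) FOLLOWS from `Z22:(8.12)`
(`Section8cStatements.Eq812`) and the four displays after (8.18) in the quantitative form
`error ≤ C·α·𝓛⁻⁷` (`h51`–`h54`), using `𝔞 ≤ 96e⁹π⁻²𝓛⁴` (`frakA_le_ell_pow_four`), `α log P = π`,
and the exact regrouping `weighted_mains_eq` into the printed `b₁₁, b₂₂, b₂₁, b₁₂` (8.19)–(8.22).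
[cite: Zhang2022LandauSiegel, §8 p.49, tex L2523] -/
theorem step8u055_of_eq812q (h812 : Eq812 c')
    (h51 : ∃ C : ℝ, ForAllLarge fun D _ _ => ∀ j ∈ ({1, 2, 3} : Finset ℕ),
      ‖1 / (Real.log (Skeleton.P1 D) : ℂ) ^ 2 *
            (∫ x in (1 : ℝ)..Skeleton.P1 D, frakfW c' D j 6 x * frakgW c' D j 6 x / x) -
          ((1 / (0.504 ^ 2 * Real.log (bigP D)) : ℝ) : ℂ) *
            ∫ z in (0 : ℝ)..0.504, ffP j 6 z * ghP j 6 z‖ ≤ C * alpha D * (ell D ^ 7)⁻¹)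
    (h52 : ∃ C : ℝ, ForAllLarge fun D _ _ => ∀ j ∈ ({1, 2, 3} : Finset ℕ),
      ‖1 / (Real.log (Skeleton.P2 D) : ℂ) ^ 2 *
            (∫ x in (1 : ℝ)..Skeleton.P2 D, frakfW c' D j 7 x * frakgW c' D j 7 x / x) -
          ((1 / (0.5 ^ 2 * Real.log (bigP D)) : ℝ) : ℂ) *
            ∫ z in (0 : ℝ)..0.5, ffP j 7 z * ghP j 7 z‖ ≤ C * alpha D * (ell D ^ 7)⁻¹)
    (h53 : ∃ C : ℝ, ForAllLarge fun D _ _ => ∀ j ∈ ({1, 2, 3} : Finset ℕ),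
      ‖1 / (Real.log (Skeleton.P1 D) * Real.log (Skeleton.P2 D) : ℂ) *
            (∫ x in (1 : ℝ)..Skeleton.P2 D, frakfW c' D j 7 x *
              frakgW c' D j 6 (bigP D ^ (0.004 : ℝ) * bigT D ^ 10 * x) / x) -
          ((1 / (0.5 * 0.504 * Real.log (bigP D)) : ℝ) : ℂ) *
            ∫ z in (0 : ℝ)..0.5, ffP j 7 z * ghP j 6 (z + 0.004)‖ ≤ C * alpha D * (ell D ^ 7)⁻¹)
    (h54 : ∃ C : ℝ, ForAllLarge fun D _ _ => ∀ j ∈ ({1, 2, 3} : Finset ℕ),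
      ‖1 / (Real.log (Skeleton.P1 D) * Real.log (Skeleton.P2 D) : ℂ) *
            (∫ x in (1 : ℝ)..Skeleton.P2 D,
              frakfW c' D j 6 (bigP D ^ (0.004 : ℝ) * bigT D ^ 10 * x) * frakgW c' D j 7 x / x) -
          ((1 / (0.5 * 0.504 * Real.log (bigP D)) : ℝ) : ℂ) *
            ∫ z in (0 : ℝ)..0.5, ffP j 6 (z + 0.004) * ghP j 7 z‖ ≤ C * alpha D * (ell D ^ 7)⁻¹) :
    Step8u055 c' := by
  intro ε hε
  obtain ⟨K, hK0, hF⟩ := sj_approx_of_eq812q c' h812 h51 h52 h53 h54 (η := ε / 8) (by positivity)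
  set A : ℝ := 96 * Real.exp 9 / π ^ 2 with hA_def
  have hA0 : 0 ≤ A := by positivity
  have FL : ForAllLarge fun D _ _ => 3 ≤ ell D ∧ 8 * A * K / ε ≤ ell D :=
    ForAllLarge.of_le (max 21 ⌈Real.exp (8 * A * K / ε)⌉₊) fun D _ _ hD _ _ =>
      ⟨three_le_ell (le_trans (le_max_left _ _) hD), le_ell_of_le (le_trans (le_max_right _ _) hD)⟩
  refine (hF.and FL).mono ?_
  intro D _ χ _ hp h hA
  obtain ⟨hS, hℓ3, hℓK⟩ := h
  have hℓ : 0 < ell D := by linarith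
  have hα : 0 < alpha D := by rw [Skeleton.alpha, log_bigP]; positivity
  have hlogP : Real.log (bigP D) ≠ 0 := by rw [log_bigP]; positivity
  have h𝔞 : frakA χ ≤ A * ell D ^ 4 := frakA_le_ell_pow_four χ hp hℓ3
  have h𝔞0 : 0 ≤ frakA χ := frakA_nonneg χ
  have b1 := hS hA 1 (by simp)
  have b2 := hS hA 2 (by simp)
  have b3 := hS hA 3 (by simp)
  set M : ℕ → ℂ := fun j =>
    ((1 / (0.504 ^ 2 * Real.log (bigP D)) : ℝ) : ℂ) *
        (∫ z in (0 : ℝ)..0.504, ffP j 6 z * ghP j 6 z) +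
      (Complex.normSq iota2 : ℂ) * (((1 / (0.5 ^ 2 * Real.log (bigP D)) : ℝ) : ℂ) *
        ∫ z in (0 : ℝ)..0.5, ffP j 7 z * ghP j 7 z) +
      iota2 * (((1 / (0.5 * 0.504 * Real.log (bigP D)) : ℝ) : ℂ) *
        ∫ z in (0 : ℝ)..0.5, ffP j 7 z * ghP j 6 (z + 0.004)) +
      conj iota2 * (((1 / (0.5 * 0.504 * Real.log (bigP D)) : ℝ) : ℂ) *
        ∫ z in (0 : ℝ)..0.5, ffP j 6 (z + 0.004) * ghP j 7 z) with hM
  have hB : 1 / (2 * (alpha D : ℂ)) * M 1 + 2 / (alpha D : ℂ) * M 2 +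
      3 / (2 * (alpha D : ℂ)) * M 3 = Theta1Coeff := by
    unfold Skeleton.alpha
    exact weighted_mains_eq hlogP M fun j => rfl
  set S : ℕ → ℂ := fun j => Sj c' D j (a11 χ) (a21 χ) with hSdef
  have eW : (1 / (2 * (alpha D : ℂ)) * S 1 + 2 / (alpha D : ℂ) * S 2 + 3 / (2 * (alpha D : ℂ)) * S 3) -
        (frakA χ : ℂ) * (b11 + iota2 * b21 + conj iota2 * b12 + (Complex.normSq iota2 : ℂ) * b22) =
      1 / (2 * (alpha D : ℂ)) * (S 1 - (frakA χ : ℂ) * M 1) +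
        2 / (alpha D : ℂ) * (S 2 - (frakA χ : ℂ) * M 2) +
        3 / (2 * (alpha D : ℂ)) * (S 3 - (frakA χ : ℂ) * M 3) := by
    rw [show (b11 + iota2 * b21 + conj iota2 * b12 + (Complex.normSq iota2 : ℂ) * b22) = Theta1Coeff
      from rfl, ← hB]
    ring
  change ‖(1 / (2 * (alpha D : ℂ)) * S 1 + 2 / (alpha D : ℂ) * S 2 + 3 / (2 * (alpha D : ℂ)) * S 3) -
      (frakA χ : ℂ) * (b11 + iota2 * b21 + conj iota2 * b12 + (Complex.normSq iota2 : ℂ) * b22)‖ ≤ ε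
  rw [eW]
  refine (norm_weighted3_le hα b1 b2 b3).trans ?_
  have hℓ1 : 1 ≤ ell D := by linarith
  have e1 : 4 * (ε / 8 * alpha D + frakA χ * K * (alpha D * (ell D ^ 7)⁻¹)) / alpha D =
      ε / 2 + 4 * (frakA χ * K) / ell D ^ 7 := by
    field_simp
    ring
  rw [e1]
  have h2 : 4 * (frakA χ * K) / ell D ^ 7 ≤ 4 * (A * K) / ell D := by
    calc 4 * (frakA χ * K) / ell D ^ 7 ≤ 4 * (A * ell D ^ 4 * K) / ell D ^ 7 := by gcongr
      _ = 4 * (A * K) / ell D ^ 3 := by field_simp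
      _ ≤ 4 * (A * K) / ell D ^ 1 :=
          div_le_div_of_nonneg_left (by positivity) (by positivity) (pow_le_pow_right₀ hℓ1 (by norm_num))
      _ = 4 * (A * K) / ell D := by rw [pow_one]
  have h3 : 4 * (A * K) / ell D ≤ ε / 2 := by
    rw [div_le_iff₀ hℓ]
    have := (div_le_iff₀ hε).mp hℓK
    nlinarith [this]
  linarith

/-! ### `Z22:§8.u056` "It follows by Proposition 7.1": with the implicit input `E(𝐚₁₁,𝐚₂₁) = o(𝔓)` -/

/-- **`Z22:§8.u056` from `§8.u055`, Proposition 7.1 and `E(𝐚₁₁,𝐚₂₁) = o(𝔓)`.** The manuscript's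
"It follows by Proposition 7.1 that `Θ₁(𝐚₁₁,𝐚₂₁) = (b₁₁ + ι₂b₂₁ + ῑ₂b₁₂ + |ι₂|²b₂₂)𝔞𝔓 + o(𝔓)`"
(p.50, tex L2546) uses, silently, that the error term `E(𝐚₁₁,𝐚₂₁) = 𝔓𝓛²Σ_j|S_j|` of Prop. 7.1 is
`o(𝔓)` (hypothesis `hE`; discharged from (8.12) in `ecal_small_of_eq812q`) and that `𝐚₁₁, 𝐚₂₁`
satisfy (7.2) (tree: `Skeleton.adm72_a11/adm72_a21`). The typed edge
`Section8dStatements.DedStep8u056` is this statement with `hE` suppressed.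
[cite: Zhang2022LandauSiegel, §8 p.50, tex L2546] -/
theorem step8u056_of (h55 : Step8u055 c')
    (hE : ∀ ε : ℝ, 0 < ε → ForAllLarge fun D _ χ => AssumptionA D χ →
      Ecal c' D (a11 χ) (a21 χ) ≤ ε * frakP D)
    (h71 : Prop71 c') : Step8u056 c' := by
  intro ε hε
  obtain ⟨C, h71'⟩ := h71 (1 + ‖iota2‖) (ε / 3) (by positivity)
  set C' : ℝ := max C 0 with hC'
  have hC'0 : 0 ≤ C' := le_max_right _ _
  have FE := hE (ε / (3 * (C' + 1))) (by positivity)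
  have F55 := h55 (ε / 3) (by positivity)
  have FL : ForAllLarge fun D _ _ => 2 ≤ Real.log D :=
    ForAllLarge.of_le 21 fun D _ _ hD _ _ => by
      have := three_le_ell hD; rw [ell] at this; linarith
  refine (((h71'.and FE).and F55).and FL).mono ?_
  intro D _ χ _ _ h hA
  obtain ⟨⟨⟨e71, eE⟩, e55⟩, hlog⟩ := h
  replace e71 := e71 hA (a11 χ) (a21 χ) (adm72_a11 χ hlog) (adm72_a21 χ hlog)
  replace eE := eE hA
  replace e55 := e55 hA
  have hP0 : 0 ≤ frakP D := frakP_nonneg D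
  have hEcal0 : 0 ≤ Ecal c' D (a11 χ) (a21 χ) := by unfold Ecal; positivity
  set Θ := Theta1 c' χ (a11 χ) (a21 χ)
  set W : ℂ := 1 / (2 * (alpha D : ℂ)) * Sj c' D 1 (a11 χ) (a21 χ) +
    2 / (alpha D : ℂ) * Sj c' D 2 (a11 χ) (a21 χ) +
    3 / (2 * (alpha D : ℂ)) * Sj c' D 3 (a11 χ) (a21 χ) with hW
  set B : ℂ := b11 + iota2 * b21 + conj iota2 * b12 + (Complex.normSq iota2 : ℂ) * b22 with hB
  have emv : mainMV c' D (a11 χ) (a21 χ) = W * (frakP D : ℂ) := by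
    rw [mainMV, hW]; ring
  have e : Θ - B * (frakA χ : ℂ) * (frakP D : ℂ) =
      (Θ - mainMV c' D (a11 χ) (a21 χ)) + (W - (frakA χ : ℂ) * B) * (frakP D : ℂ) := by
    rw [emv]; ring
  rw [e]
  have n2 : ‖(W - (frakA χ : ℂ) * B) * (frakP D : ℂ)‖ ≤ ε / 3 * frakP D := by
    rw [norm_mul, Complex.norm_of_nonneg hP0]
    exact mul_le_mul_of_nonneg_right e55 hP0
  have n1 : ‖Θ - mainMV c' D (a11 χ) (a21 χ)‖ ≤ ε / 3 * frakP D + ε / 3 * frakP D := by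
    refine e71.trans (add_le_add ?_ le_rfl)
    calc C * Ecal c' D (a11 χ) (a21 χ) ≤ C' * Ecal c' D (a11 χ) (a21 χ) :=
          mul_le_mul_of_nonneg_right (le_max_left _ _) hEcal0
      _ ≤ C' * (ε / (3 * (C' + 1)) * frakP D) := mul_le_mul_of_nonneg_left eE hC'0
      _ = C' / (C' + 1) * (ε / 3 * frakP D) := by field_simp
      _ ≤ 1 * (ε / 3 * frakP D) := by
          apply mul_le_mul_of_nonneg_right _ (by positivity)
          rw [div_le_one (by positivity)]; linarith
      _ = ε / 3 * frakP D := one_mul _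
  calc ‖Θ - mainMV c' D (a11 χ) (a21 χ) + (W - (frakA χ : ℂ) * B) * (frakP D : ℂ)‖
      ≤ ‖Θ - mainMV c' D (a11 χ) (a21 χ)‖ + ‖(W - (frakA χ : ℂ) * B) * (frakP D : ℂ)‖ :=
        norm_add_le _ _
    _ ≤ (ε / 3 * frakP D + ε / 3 * frakP D) + ε / 3 * frakP D := add_le_add n1 n2
    _ = ε * frakP D := by ring

/-- The typed edge `Z22:§8.u056` (`Section8dStatements.DedStep8u056 c′ : Step8u055 c′ → Prop71 c′ →
Step8u056 c′`) HOLDS GIVEN its implicit input `E(𝐚₁₁,𝐚₂₁) = o(𝔓)`.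
[cite: Zhang2022LandauSiegel, §8 p.50, tex L2545] -/
theorem dedStep8u056_of_ecal
    (hE : ∀ ε : ℝ, 0 < ε → ForAllLarge fun D _ χ => AssumptionA D χ →
      Ecal c' D (a11 χ) (a21 χ) ≤ ε * frakP D) :
    DedStep8u056 c' := fun h55 h71 => step8u056_of c' h55 hE h71

/-! ### The implicit input `E(𝐚₁₁,𝐚₂₁) = o(𝔓)`, discharged from (8.12) -/

/-- Norm of the four-term `z`-main term: `‖M_j‖ ≤ K_j/log P` with `K_j` an absolute constant
(the `z`-integrals do not depend on `D`). [cite: Zhang2022LandauSiegel, §8 p.49] -/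
theorem norm_main_le {L : ℝ} (hL : 0 < L) (J₁ J₂ J₃ J₄ : ℂ) :
    ‖(((1 / (0.504 ^ 2 * L)) : ℝ) : ℂ) * J₁ +
        (Complex.normSq iota2 : ℂ) * ((((1 / (0.5 ^ 2 * L)) : ℝ) : ℂ) * J₂) +
        iota2 * ((((1 / (0.5 * 0.504 * L)) : ℝ) : ℂ) * J₃) +
        conj iota2 * ((((1 / (0.5 * 0.504 * L)) : ℝ) : ℂ) * J₄)‖ ≤
      (‖J₁‖ / 0.504 ^ 2 + Complex.normSq iota2 * (‖J₂‖ / 0.5 ^ 2) +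
        ‖iota2‖ * (‖J₃‖ / (0.5 * 0.504)) + ‖iota2‖ * (‖J₄‖ / (0.5 * 0.504))) / L := by
  have hr : ∀ r : ℝ, 0 < r → ∀ J : ℂ, ‖((r : ℝ) : ℂ) * J‖ = r * ‖J‖ := fun r hr J => by
    rw [norm_mul, Complex.norm_real, Real.norm_eq_abs, abs_of_pos hr]
  have hn : ‖(Complex.normSq iota2 : ℂ)‖ = Complex.normSq iota2 :=
    Complex.norm_of_nonneg (Complex.normSq_nonneg _)
  have h1 : (0 : ℝ) < 1 / (0.504 ^ 2 * L) := by positivity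
  have h2 : (0 : ℝ) < 1 / (0.5 ^ 2 * L) := by positivity
  have h3 : (0 : ℝ) < 1 / (0.5 * 0.504 * L) := by positivity
  refine (norm_add_le _ _).trans ?_
  refine (add_le_add (norm_add₃_le) le_rfl).trans ?_
  simp only [norm_mul, Complex.norm_conj, hn, Complex.norm_real, Real.norm_eq_abs,
    abs_of_pos h1, abs_of_pos h2, abs_of_pos h3]
  apply le_of_eq
  field_simp

/-- **`E(𝐚₁₁,𝐚₂₁) = o(𝔓)`, DISCHARGED from (8.12)** (the implicit input of "It follows by
Proposition 7.1", p.50): by (8.12) and the substitution displays, `S_j(𝐚₁₁,𝐚₂₁) ≪ 𝔞/log P + α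
≪ 𝓛⁴·𝓛⁻⁹`, so `E(𝐚₁₁,𝐚₂₁) = 𝔓𝓛²Σ_{j≤3}|S_j| ≪ 𝔓𝓛⁻³ = o(𝔓)` (`𝔞 ≤ 96e⁹π⁻²𝓛⁴`,
`frakA_le_ell_pow_four`). [cite: Zhang2022LandauSiegel, §7 Prop. 7.1, §8 p.50, tex L2546] -/
theorem ecal_small_of_eq812q (h812 : Eq812 c')
    (h51 : ∃ C : ℝ, ForAllLarge fun D _ _ => ∀ j ∈ ({1, 2, 3} : Finset ℕ),
      ‖1 / (Real.log (Skeleton.P1 D) : ℂ) ^ 2 *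
            (∫ x in (1 : ℝ)..Skeleton.P1 D, frakfW c' D j 6 x * frakgW c' D j 6 x / x) -
          ((1 / (0.504 ^ 2 * Real.log (bigP D)) : ℝ) : ℂ) *
            ∫ z in (0 : ℝ)..0.504, ffP j 6 z * ghP j 6 z‖ ≤ C * alpha D * (ell D ^ 7)⁻¹)
    (h52 : ∃ C : ℝ, ForAllLarge fun D _ _ => ∀ j ∈ ({1, 2, 3} : Finset ℕ),
      ‖1 / (Real.log (Skeleton.P2 D) : ℂ) ^ 2 *
            (∫ x in (1 : ℝ)..Skeleton.P2 D, frakfW c' D j 7 x * frakgW c' D j 7 x / x) -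
          ((1 / (0.5 ^ 2 * Real.log (bigP D)) : ℝ) : ℂ) *
            ∫ z in (0 : ℝ)..0.5, ffP j 7 z * ghP j 7 z‖ ≤ C * alpha D * (ell D ^ 7)⁻¹)
    (h53 : ∃ C : ℝ, ForAllLarge fun D _ _ => ∀ j ∈ ({1, 2, 3} : Finset ℕ),
      ‖1 / (Real.log (Skeleton.P1 D) * Real.log (Skeleton.P2 D) : ℂ) *
            (∫ x in (1 : ℝ)..Skeleton.P2 D, frakfW c' D j 7 x *
              frakgW c' D j 6 (bigP D ^ (0.004 : ℝ) * bigT D ^ 10 * x) / x) -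
          ((1 / (0.5 * 0.504 * Real.log (bigP D)) : ℝ) : ℂ) *
            ∫ z in (0 : ℝ)..0.5, ffP j 7 z * ghP j 6 (z + 0.004)‖ ≤ C * alpha D * (ell D ^ 7)⁻¹)
    (h54 : ∃ C : ℝ, ForAllLarge fun D _ _ => ∀ j ∈ ({1, 2, 3} : Finset ℕ),
      ‖1 / (Real.log (Skeleton.P1 D) * Real.log (Skeleton.P2 D) : ℂ) *
            (∫ x in (1 : ℝ)..Skeleton.P2 D,
              frakfW c' D j 6 (bigP D ^ (0.004 : ℝ) * bigT D ^ 10 * x) * frakgW c' D j 7 x / x) -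
          ((1 / (0.5 * 0.504 * Real.log (bigP D)) : ℝ) : ℂ) *
            ∫ z in (0 : ℝ)..0.5, ffP j 6 (z + 0.004) * ghP j 7 z‖ ≤ C * alpha D * (ell D ^ 7)⁻¹) :
    ∀ ε : ℝ, 0 < ε → ForAllLarge fun D _ χ => AssumptionA D χ →
      Ecal c' D (a11 χ) (a21 χ) ≤ ε * frakP D := by
  intro ε hε
  obtain ⟨K, hK0, hF⟩ := sj_approx_of_eq812q c' h812 h51 h52 h53 h54 (η := 1) one_pos
  set A : ℝ := 96 * Real.exp 9 / π ^ 2 with hA_def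
  have hA0 : 0 ≤ A := by positivity
  -- the absolute constants `K_j` bounding the `z`-main terms
  set Kp : ℕ → ℝ := fun j =>
    ‖∫ z in (0 : ℝ)..0.504, ffP j 6 z * ghP j 6 z‖ / 0.504 ^ 2 +
      Complex.normSq iota2 * (‖∫ z in (0 : ℝ)..0.5, ffP j 7 z * ghP j 7 z‖ / 0.5 ^ 2) +
      ‖iota2‖ * (‖∫ z in (0 : ℝ)..0.5, ffP j 7 z * ghP j 6 (z + 0.004)‖ / (0.5 * 0.504)) +
      ‖iota2‖ * (‖∫ z in (0 : ℝ)..0.5, ffP j 6 (z + 0.004) * ghP j 7 z‖ / (0.5 * 0.504)) with hKp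
  have hKp0 : ∀ j, 0 ≤ Kp j := fun j => by
    have := Complex.normSq_nonneg iota2; simp only [hKp]; positivity
  set Kt : ℝ := Kp 1 + Kp 2 + Kp 3 with hKt
  have hKt0 : 0 ≤ Kt := by have := hKp0 1; have := hKp0 2; have := hKp0 3; linarith
  set Q : ℝ := π + A * K * π + A * Kt with hQ
  have hQ0 : 0 ≤ Q := by positivity
  have FL : ForAllLarge fun D _ _ => 3 ≤ ell D ∧ 3 * Q / ε ≤ ell D :=
    ForAllLarge.of_le (max 21 ⌈Real.exp (3 * Q / ε)⌉₊) fun D _ _ hD _ _ =>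
      ⟨three_le_ell (le_trans (le_max_left _ _) hD), le_ell_of_le (le_trans (le_max_right _ _) hD)⟩
  refine (hF.and FL).mono ?_
  intro D _ χ _ hp h hA
  obtain ⟨hS, hℓ3, hℓQ⟩ := h
  have hℓ : 0 < ell D := by linarith
  have hℓ1 : 1 ≤ ell D := by linarith
  have hlogP : 0 < Real.log (bigP D) := by rw [log_bigP]; positivity
  have h𝔞 : frakA χ ≤ A * ell D ^ 4 := frakA_le_ell_pow_four χ hp hℓ3
  have h𝔞0 : 0 ≤ frakA χ := frakA_nonneg χ
  have hP0 : 0 ≤ frakP D := frakP_nonneg D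
  -- `‖S_j‖ ≤ Q/𝓛³` for `j = 1, 2, 3`
  have hSj : ∀ j ∈ ({1, 2, 3} : Finset ℕ), ‖Sj c' D j (a11 χ) (a21 χ)‖ ≤ Q / ell D ^ 3 := by
    intro j hj
    have hKpj : Kp j ≤ Kt := by
      simp only [Finset.mem_insert, Finset.mem_singleton] at hj
      have := hKp0 1; have := hKp0 2; have := hKp0 3
      rcases hj with rfl | rfl | rfl <;> simp only [hKt] <;> linarith
    have e1 := hS hA j hj
    set S : ℂ := Sj c' D j (a11 χ) (a21 χ)
    set M : ℂ := ((1 / (0.504 ^ 2 * Real.log (bigP D)) : ℝ) : ℂ) *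
        (∫ z in (0 : ℝ)..0.504, ffP j 6 z * ghP j 6 z) +
      (Complex.normSq iota2 : ℂ) * (((1 / (0.5 ^ 2 * Real.log (bigP D)) : ℝ) : ℂ) *
        ∫ z in (0 : ℝ)..0.5, ffP j 7 z * ghP j 7 z) +
      iota2 * (((1 / (0.5 * 0.504 * Real.log (bigP D)) : ℝ) : ℂ) *
        ∫ z in (0 : ℝ)..0.5, ffP j 7 z * ghP j 6 (z + 0.004)) +
      conj iota2 * (((1 / (0.5 * 0.504 * Real.log (bigP D)) : ℝ) : ℂ) *
        ∫ z in (0 : ℝ)..0.5, ffP j 6 (z + 0.004) * ghP j 7 z) with hM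
    have hMle : ‖M‖ ≤ Kp j / Real.log (bigP D) := norm_main_le hlogP _ _ _ _
    have eS : S = (S - (frakA χ : ℂ) * M) + (frakA χ : ℂ) * M := by ring
    have n : ‖S‖ ≤ (1 * alpha D + frakA χ * K * (alpha D * (ell D ^ 7)⁻¹)) +
        frakA χ * (Kp j / Real.log (bigP D)) := by
      rw [eS]
      refine (norm_add_le _ _).trans (add_le_add e1 ?_)
      rw [norm_mul, Complex.norm_of_nonneg h𝔞0]
      exact mul_le_mul_of_nonneg_left hMle h𝔞0
    refine n.trans ?_
    rw [Skeleton.alpha, log_bigP]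
    -- each of the three terms is `≤ (its constant)/𝓛³`
    have hp3 : ∀ n : ℕ, 3 ≤ n → ∀ X : ℝ, 0 ≤ X → X / ell D ^ n ≤ X / ell D ^ 3 :=
      fun n hn X hX => div_le_div_of_nonneg_left hX (by positivity) (pow_le_pow_right₀ hℓ1 hn)
    have t1 : 1 * (π / ell D ^ 9) ≤ π / ell D ^ 3 := by
      rw [one_mul]; exact hp3 9 (by norm_num) π Real.pi_pos.le
    have t2 : frakA χ * K * (π / ell D ^ 9 * (ell D ^ 7)⁻¹) ≤ A * K * π / ell D ^ 3 := by
      calc frakA χ * K * (π / ell D ^ 9 * (ell D ^ 7)⁻¹)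
          ≤ A * ell D ^ 4 * K * (π / ell D ^ 9 * (ell D ^ 7)⁻¹) := by gcongr
        _ = A * K * π / ell D ^ 12 := by field_simp
        _ ≤ A * K * π / ell D ^ 3 := hp3 12 (by norm_num) _ (by positivity)
    have t3 : frakA χ * (Kp j / ell D ^ 9) ≤ A * Kt / ell D ^ 3 := by
      calc frakA χ * (Kp j / ell D ^ 9) ≤ A * ell D ^ 4 * (Kt / ell D ^ 9) := by
            gcongr
            exact div_nonneg (hKp0 j) (by positivity)
        _ = A * Kt / ell D ^ 5 := by field_simp
        _ ≤ A * Kt / ell D ^ 3 := hp3 5 (by norm_num) _ (by positivity)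
    have : π / ell D ^ 3 + A * K * π / ell D ^ 3 + A * Kt / ell D ^ 3 = Q / ell D ^ 3 := by
      rw [hQ]; ring
    linarith
  have b1 := hSj 1 (by simp)
  have b2 := hSj 2 (by simp)
  have b3 := hSj 3 (by simp)
  have hℓ3' : (0 : ℝ) < ell D ^ 3 := by positivity
  unfold Ecal
  calc frakP D * ell D ^ 2 *
        (‖Sj c' D 1 (a11 χ) (a21 χ)‖ + ‖Sj c' D 2 (a11 χ) (a21 χ)‖ + ‖Sj c' D 3 (a11 χ) (a21 χ)‖)
      ≤ frakP D * ell D ^ 2 * (Q / ell D ^ 3 + Q / ell D ^ 3 + Q / ell D ^ 3) := by gcongr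
    _ = (3 * Q / ell D) * frakP D := by field_simp; ring
    _ ≤ ε * frakP D := by
        apply mul_le_mul_of_nonneg_right _ hP0
        rw [div_le_iff₀ hℓ]
        have := (div_le_iff₀ hε).mp hℓQ
        linarith

/-! ### Assembly: `Skeleton.Ded823 c′` from (8.12) and the quantitative substitution displays -/

/-- **The top of the `Ded823` chain, closed in the kernel**: (8.12) (`Z22:(8.12)`,
`Section8cStatements.Eq812`) together with the four quantitative "Substituting `x = Pᶻ`" displays
(`Z22:§8.u051`–`§8.u054` with error `≤ Cα𝓛⁻⁷`) IMPLY the skeleton's deduction node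
`Skeleton.Ded823 c′ : Eq87 → Prop71 → Lemma82 → Lemma83 → Lemma84 → Eval823` — via
`§8.u055` (`step8u055_of_eq812q`), `E(𝐚₁₁,𝐚₂₁) = o(𝔓)` (`ecal_small_of_eq812q`), `§8.u056`
(`step8u056_of`, Prop. 7.1) and (8.23) (`Section8dStatements.dedEval823_holds`, (8.7)). The three
lemma antecedents of `Ded823` are consumed UPSTREAM of (8.12) (the front end `Z22:§8.u040`–`(8.11)`,
other seats); at this level they are not used. [cite: Zhang2022LandauSiegel, §8 (8.12)–(8.23) pp.48–50] -/
theorem ded823_of_eq812q (h812 : Eq812 c')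
    (h51 : ∃ C : ℝ, ForAllLarge fun D _ _ => ∀ j ∈ ({1, 2, 3} : Finset ℕ),
      ‖1 / (Real.log (Skeleton.P1 D) : ℂ) ^ 2 *
            (∫ x in (1 : ℝ)..Skeleton.P1 D, frakfW c' D j 6 x * frakgW c' D j 6 x / x) -
          ((1 / (0.504 ^ 2 * Real.log (bigP D)) : ℝ) : ℂ) *
            ∫ z in (0 : ℝ)..0.504, ffP j 6 z * ghP j 6 z‖ ≤ C * alpha D * (ell D ^ 7)⁻¹)
    (h52 : ∃ C : ℝ, ForAllLarge fun D _ _ => ∀ j ∈ ({1, 2, 3} : Finset ℕ),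
      ‖1 / (Real.log (Skeleton.P2 D) : ℂ) ^ 2 *
            (∫ x in (1 : ℝ)..Skeleton.P2 D, frakfW c' D j 7 x * frakgW c' D j 7 x / x) -
          ((1 / (0.5 ^ 2 * Real.log (bigP D)) : ℝ) : ℂ) *
            ∫ z in (0 : ℝ)..0.5, ffP j 7 z * ghP j 7 z‖ ≤ C * alpha D * (ell D ^ 7)⁻¹)
    (h53 : ∃ C : ℝ, ForAllLarge fun D _ _ => ∀ j ∈ ({1, 2, 3} : Finset ℕ),
      ‖1 / (Real.log (Skeleton.P1 D) * Real.log (Skeleton.P2 D) : ℂ) *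
            (∫ x in (1 : ℝ)..Skeleton.P2 D, frakfW c' D j 7 x *
              frakgW c' D j 6 (bigP D ^ (0.004 : ℝ) * bigT D ^ 10 * x) / x) -
          ((1 / (0.5 * 0.504 * Real.log (bigP D)) : ℝ) : ℂ) *
            ∫ z in (0 : ℝ)..0.5, ffP j 7 z * ghP j 6 (z + 0.004)‖ ≤ C * alpha D * (ell D ^ 7)⁻¹)
    (h54 : ∃ C : ℝ, ForAllLarge fun D _ _ => ∀ j ∈ ({1, 2, 3} : Finset ℕ),
      ‖1 / (Real.log (Skeleton.P1 D) * Real.log (Skeleton.P2 D) : ℂ) *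
            (∫ x in (1 : ℝ)..Skeleton.P2 D,
              frakfW c' D j 6 (bigP D ^ (0.004 : ℝ) * bigT D ^ 10 * x) * frakgW c' D j 7 x / x) -
          ((1 / (0.5 * 0.504 * Real.log (bigP D)) : ℝ) : ℂ) *
            ∫ z in (0 : ℝ)..0.5, ffP j 6 (z + 0.004) * ghP j 7 z‖ ≤ C * alpha D * (ell D ^ 7)⁻¹) :
    Ded823 c' := by
  intro h87 h71 _ _ _
  have h55 := step8u055_of_eq812q c' h812 h51 h52 h53 h54
  have hE := ecal_small_of_eq812q c' h812 h51 h52 h53 h54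
  exact dedEval823_holds c' h87 (step8u056_of c' h55 hE h71)

/-- **The whole refined `Ded823` chain, composed in the kernel.** `Skeleton.Ded823 c′` follows from
the typed sub-deductions of §8 pp. 47–48 (`Section8cStatements.DedStep8u044`, `Eq810`,
`DedStep8u046`, `Step8u047`, `Step8u048`, `Ded811`; `Ded812` is PROVED there, `ded812_holds`), the
four applications of Lemmas 8.2/8.4 (`Step8u040`–`Step8u043` as consequences of the lemma nodes),
and the quantitative substitution displays (`h51`–`h54`) — this theorem is the exact list of what the
other D01 seats must land for `Ded823` to be DISCHARGED (no edge of the printed route is missing).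
[cite: Zhang2022LandauSiegel, §8 (8.9)–(8.23) pp.46–50] -/
theorem ded823_of_refinement
    (h40 : Lemma82 c' → Step8u040 c') (h41 : Lemma82 c' → Step8u041 c')
    (h42 : Lemma83 c' → Lemma84 c' → Step8u042 c') (h43 : Lemma83 c' → Lemma84 c' → Step8u043 c')
    (h44 : DedStep8u044 c') (h810 : Eq810) (h46 : DedStep8u046 c') (h47 : Step8u047 c')
    (h48 : Step8u048) (h811 : Ded811 c')
    (h51 : ∃ C : ℝ, ForAllLarge fun D _ _ => ∀ j ∈ ({1, 2, 3} : Finset ℕ),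
      ‖1 / (Real.log (Skeleton.P1 D) : ℂ) ^ 2 *
            (∫ x in (1 : ℝ)..Skeleton.P1 D, frakfW c' D j 6 x * frakgW c' D j 6 x / x) -
          ((1 / (0.504 ^ 2 * Real.log (bigP D)) : ℝ) : ℂ) *
            ∫ z in (0 : ℝ)..0.504, ffP j 6 z * ghP j 6 z‖ ≤ C * alpha D * (ell D ^ 7)⁻¹)
    (h52 : ∃ C : ℝ, ForAllLarge fun D _ _ => ∀ j ∈ ({1, 2, 3} : Finset ℕ),
      ‖1 / (Real.log (Skeleton.P2 D) : ℂ) ^ 2 *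
            (∫ x in (1 : ℝ)..Skeleton.P2 D, frakfW c' D j 7 x * frakgW c' D j 7 x / x) -
          ((1 / (0.5 ^ 2 * Real.log (bigP D)) : ℝ) : ℂ) *
            ∫ z in (0 : ℝ)..0.5, ffP j 7 z * ghP j 7 z‖ ≤ C * alpha D * (ell D ^ 7)⁻¹)
    (h53 : ∃ C : ℝ, ForAllLarge fun D _ _ => ∀ j ∈ ({1, 2, 3} : Finset ℕ),
      ‖1 / (Real.log (Skeleton.P1 D) * Real.log (Skeleton.P2 D) : ℂ) *
            (∫ x in (1 : ℝ)..Skeleton.P2 D, frakfW c' D j 7 x *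
              frakgW c' D j 6 (bigP D ^ (0.004 : ℝ) * bigT D ^ 10 * x) / x) -
          ((1 / (0.5 * 0.504 * Real.log (bigP D)) : ℝ) : ℂ) *
            ∫ z in (0 : ℝ)..0.5, ffP j 7 z * ghP j 6 (z + 0.004)‖ ≤ C * alpha D * (ell D ^ 7)⁻¹)
    (h54 : ∃ C : ℝ, ForAllLarge fun D _ _ => ∀ j ∈ ({1, 2, 3} : Finset ℕ),
      ‖1 / (Real.log (Skeleton.P1 D) * Real.log (Skeleton.P2 D) : ℂ) *
            (∫ x in (1 : ℝ)..Skeleton.P2 D,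
              frakfW c' D j 6 (bigP D ^ (0.004 : ℝ) * bigT D ^ 10 * x) * frakgW c' D j 7 x / x) -
          ((1 / (0.5 * 0.504 * Real.log (bigP D)) : ℝ) : ℂ) *
            ∫ z in (0 : ℝ)..0.5, ffP j 6 (z + 0.004) * ghP j 7 z‖ ≤ C * alpha D * (ell D ^ 7)⁻¹) :
    Ded823 c' := by
  intro h87 h71 h82 h83 h84
  have h812 : Eq812 c' :=
    ded812_holds c' (h811 (h46 (h44 (h40 h82) (h41 h82) (h42 h83 h84) (h43 h83 h84)) h810) h47 h48)
  exact ded823_of_eq812q c' h812 h51 h52 h53 h54 h87 h71 h82 h83 h84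

end Main

end Literature.NumberTheory.LFunctions.Zhang2022.Section8Ded823
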